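import Literature.NumberTheory.Sieve.DrappeauDispersionS1Phase
import HarnessLib

/-!
# Drappeau 2017, §5.5: splitting the moduli into classes modulo `n₀a₂`

Topic `Literature/NumberTheory/Sieve`, part of the formalisation of §5 of S. Drappeau, Proc. London
Math. Soc. (3) 114 (2017) 684–732 = arXiv:1504.05549 (Theorem 5.1 = the named fact
`Literature.NumberTheory.Sieve.Drappeau2017_theorem51`).  Everything here is PROVED; no definition
and no named fact is introduced.

§5.5 (arXiv p. 20): "we split the sums over `q₁, q₂` into congruence classes modulo `n₀a₂`.  We
obtain `|ℛ₁'| ≪ x^ε (n₀|a₂|)² (Mq₀/Q²) sup_ξ sup_{λ₁,λ₂ mod n₀a₂} ℛ₁''`", where inside the class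
`q_j ≡ λ_j` the phase `e(−a₁h\overline{q₀q₁q₂n₁}/(a₂n₀))` of (5.22) becomes
`e(−a₁h\overline{q₀λ₁λ₂n₁}/(a₂n₀))`, independent of the smooth variables `q₁, q₂`.  The three
ingredients:

* `Drappeau2017.sum_eq_sum_range_sum_filter_mod` — `∑_{q∈A} F(q) = ∑_{λ<m} ∑_{q∈A, q≡λ (m)} F(q)`;
* `Drappeau2017.intCast_prod_eq_of_mod_eq` — inside the classes the inverse
  `\overline{q₀q₁q₂n₁} (m)` only depends on `λ₁, λ₂`;
* `Drappeau2017.norm_sum_range_sum_range_le` — `|∑_{λ₁,λ₂<m} F| ≤ m² sup|F|`.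

## References

* S. Drappeau, Proc. London Math. Soc. (3) 114 (2017) 684–732, arXiv:1504.05549, §5.5, (5.23).
  [cite: Drappeau2017, §5.5]
-/

noncomputable section

open Finset

namespace Literature.NumberTheory.Sieve

namespace Drappeau2017

/-- **Classes modulo `m`**: `∑_{q∈A} F(q) = ∑_{λ<m} ∑_{q∈A, q mod m = λ} F(q)` (`m ≥ 1`).
[cite: Drappeau2017, §5.5] -/
theorem sum_eq_sum_range_sum_filter_mod {m : ℕ} (hm : 0 < m) (A : Finset ℕ) (F : ℕ → ℂ) :
    ∑ q ∈ A, F q = ∑ l ∈ Finset.range m, ∑ q ∈ A.filter (fun q : ℕ => q % m = l), F q :=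
  (Finset.sum_fiberwise_of_maps_to (s := A) (t := Finset.range m) (g := fun q : ℕ => q % m)
    (fun q _ => Finset.mem_range.2 (Nat.mod_lt q hm)) F).symm

/-- Inside the class `q ≡ l (m)` (`l < m`): `q = l` in `ZMod m`. [folklore] -/
theorem natCast_eq_of_mod_eq {m q l : ℕ} (h : q % m = l) : (q : ZMod m) = (l : ZMod m) := by
  rw [← ZMod.natCast_mod q m, h]

/-- **The inverse `\overline{q₀q₁q₂n₁} (m)` only depends on the classes of `q₁, q₂`**: for
`q_j ≡ λ_j (m)`, `q₀q₁q₂n₁ = q₀λ₁λ₂n₁` in `ZMod m` (so the phase `e(−a₁h\overline{q₀q₁q₂n₁}/(a₂n₀))`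
of (5.22), `m = n₀|a₂|`, is constant on the class). [cite: Drappeau2017, §5.5] -/
theorem intCast_prod_eq_of_mod_eq {m q₀ q₁ q₂ n₁ l₁ l₂ : ℕ} (h₁ : q₁ % m = l₁) (h₂ : q₂ % m = l₂) :
    ((((q₀ : ℤ) * q₁ * q₂ * n₁ : ℤ)) : ZMod m) = ((((q₀ : ℤ) * l₁ * l₂ * n₁ : ℤ)) : ZMod m) := by
  push_cast
  rw [natCast_eq_of_mod_eq h₁, natCast_eq_of_mod_eq h₂]

/-- `|∑_{λ₁<m} ∑_{λ₂<m} F(λ₁,λ₂)| ≤ m² C` when `|F| ≤ C`. [folklore] -/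
theorem norm_sum_range_sum_range_le {m : ℕ} {F : ℕ → ℕ → ℂ} {C : ℝ}
    (hF : ∀ l₁ ∈ Finset.range m, ∀ l₂ ∈ Finset.range m, ‖F l₁ l₂‖ ≤ C) :
    ‖∑ l₁ ∈ Finset.range m, ∑ l₂ ∈ Finset.range m, F l₁ l₂‖ ≤ (m : ℝ) ^ 2 * C := by
  calc ‖∑ l₁ ∈ Finset.range m, ∑ l₂ ∈ Finset.range m, F l₁ l₂‖
      ≤ ∑ l₁ ∈ Finset.range m, ∑ l₂ ∈ Finset.range m, C := by
        refine (norm_sum_le _ _).trans (Finset.sum_le_sum fun l₁ h₁ => ?_)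
        exact (norm_sum_le _ _).trans (Finset.sum_le_sum fun l₂ h₂ => hF l₁ h₁ l₂ h₂)
    _ = (m : ℝ) ^ 2 * C := by
        rw [Finset.sum_const, Finset.sum_const, Finset.card_range, smul_smul, nsmul_eq_mul]
        push_cast; ring

end Drappeau2017

end Literature.NumberTheory.Sieve

end
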